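import Mathlib.RingTheory.GradedAlgebra.Basic
import Mathlib.Algebra.GroupWithZero.NonZeroDivisors
import HarnessLib

/-!
# The degree-zero retraction of a `ℤ`-graded ring (crux `FInjectiveMacaulayfication`, line `Sketch`)

Support file for crux stmt-ResolutionOfSingularities-15315 (`FrobeniusLadder.FInjectiveMacaulayfication`,
line `Sketch`), stub `stub_projZeroRetract` of the cycle-4 DEGREE-ZERO DESCENT package. The descent
engine (`stub_clauseOfRetract`) consumes a ring inclusion `A ⊆ B` together with an `A`-linear retraction
`ρ : B →ₗ[A] A`; its geometric instance is a (weighted) blow-up chart, where `B = T` is a `ℤ`-graded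
commutative ring (a localised extended Rees algebra) and `A = T₀` is its degree-zero subring. This file
supplies that retraction abstractly, for any commutative ring `T` graded Mathlib-style by additive
subgroups `𝒜 : ℤ → AddSubgroup T` with `[GradedRing 𝒜]` (`𝒜 0` is a commutative ring by
`SetLike.GradeZero.instCommRing` and `T` is an `𝒜 0`-algebra by the subsemiring algebra structure,
`SetLike.GradeZero.algebraMap_apply`):

* `stub_projZeroRetract` — the projection `t ↦ t₀ = DirectSum.decompose 𝒜 t 0` is an `𝒜 0`-linear map
  `T →ₗ[𝒜 0] 𝒜 0` restricting to the identity on `𝒜 0` (Mathlib's `GradedRing.projZeroRingHom'` needs a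
  canonically ordered grading monoid, so does not apply to `ℤ`; for `ℤ` the projection is only
  `𝒜 0`-linear, not multiplicative, which is all the descent needs);
* `sub_one_mem_nonZeroDivisors` (ride-along) — for a homogeneous `u ∈ 𝒜 k` of POSITIVE degree
  `k > 0`, the element `u - 1` is a non-zero-divisor of `T`: if `(u - 1) c = 0` then `c_m = u c_{m-k}`
  in every degree `m`, and at the least degree `m` of the (finite) support of `c` the right-hand side
  vanishes. (No unit hypothesis on `u` is needed.)

All proofs are glue on Mathlib (`DirectSum.decompose`, `DirectSum.coe_decompose_mul_of_left_mem_zero`,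
`DirectSum.coe_decompose_mul_add_of_left_mem`, `DFinsupp.support`); no definitions, no named facts.
-/

-- single-problem summit: the doubled namespace component is forced
set_option linter.dupNamespace false

namespace Summit.ResolutionOfSingularities.ResolutionOfSingularities.Theorems.FInjectiveMacaulayfication.GradedZero

open DirectSum

/-- Homogeneous components commute with the scalar action of the degree-zero subring: for `a ∈ 𝒜 0`
and `t : T`, `(a • t)_j = a * t_j` (`DirectSum.coe_decompose_mul_of_left_mem_zero`, the action being
`a • t = a * t`). [folklore] -/
theorem coe_decompose_smul {ι T : Type} [DecidableEq ι] [AddMonoid ι] [CommRing T]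
    (𝒜 : ι → AddSubgroup T) [GradedRing 𝒜] (a : 𝒜 0) (t : T) (j : ι) :
    (decompose 𝒜 (a • t) j : T) = a * decompose 𝒜 t j := by
  rw [Algebra.smul_def, SetLike.GradeZero.algebraMap_apply]
  exact coe_decompose_mul_of_left_mem_zero 𝒜 a.2

/-- The component of degree `i` of a homogeneous element of degree `i` is the element itself, as an
equality in `𝒜 i` (`DirectSum.decompose_coe`, `DirectSum.of_eq_same`). [folklore] -/
theorem decompose_coe_same {ι T : Type} [DecidableEq ι] [AddMonoid ι] [CommRing T]
    (𝒜 : ι → AddSubgroup T) [GradedRing 𝒜] {i : ι} (a : 𝒜 i) :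
    decompose 𝒜 (a : T) i = a := by
  rw [decompose_coe, of_eq_same]

/-- **The degree-zero retraction of a `ℤ`-graded commutative ring.** For a commutative ring `T` graded
by additive subgroups `𝒜 : ℤ → AddSubgroup T`, the projection onto the degree-zero component
`t ↦ t₀ = DirectSum.decompose 𝒜 t 0` is an `𝒜 0`-linear map `ρ : T →ₗ[𝒜 0] 𝒜 0` (additive by
`DirectSum.decompose_add`, `𝒜 0`-linear by `(a t)_0 = a t_0` for `a ∈ 𝒜 0`) with `ρ a = a` for every
`a ∈ 𝒜 0`; in particular `ρ 1 = 1` and `𝒜 0` is a direct summand of `T` as an `𝒜 0`-module — the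
input of the degree-zero descent `stub_clauseOfRetract` for a blow-up chart `T₀ ⊆ T`. [folklore] -/
theorem stub_projZeroRetract : ∀ (T : Type) [CommRing T] (𝒜 : ℤ → AddSubgroup T) [GradedRing 𝒜],
    ∃ ρ : T →ₗ[𝒜 0] 𝒜 0, ∀ a : 𝒜 0, ρ (a : T) = a := by
  intro T _ 𝒜 _
  refine ⟨{ toFun := fun t => decompose 𝒜 t 0
            map_add' := fun x y => by rw [decompose_add, add_apply]
            map_smul' := fun a t => ?_ }, fun a => decompose_coe_same 𝒜 a⟩
  apply Subtype.ext
  rw [RingHom.id_apply, smul_eq_mul, SetLike.GradeZero.coe_mul]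
  exact coe_decompose_smul 𝒜 a t 0

/-- **A homogeneous element of positive degree minus one is a non-zero-divisor.** In a commutative ring
`T` graded by `𝒜 : ℤ → AddSubgroup T`, if `u ∈ 𝒜 k` with `0 < k` then `u - 1 ∈ nonZeroDivisors T`.
Proof: if `(u - 1) c = 0` then `u c = c`, so comparing components of degree `m = k + (m - k)` gives
`c_m = u · c_{m-k}` (`DirectSum.coe_decompose_mul_add_of_left_mem`); if `c ≠ 0` let `m` be the least
element of the finite support of `decompose 𝒜 c`; then `m - k < m` is outside the support, so
`c_{m-k} = 0` and hence `c_m = 0`, a contradiction. (Typical use: `u = a tᵏ` a homogeneous unit of the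
localised extended Rees algebra of a weighted blow-up chart; no unit hypothesis is needed.) [folklore] -/
theorem sub_one_mem_nonZeroDivisors (T : Type) [CommRing T] (𝒜 : ℤ → AddSubgroup T) [GradedRing 𝒜]
    (k : ℤ) (hk : 0 < k) (u : T) (hu : u ∈ 𝒜 k) : u - 1 ∈ nonZeroDivisors T := by
  classical
  rw [mem_nonZeroDivisors_iff_left]
  intro c hc
  have huc : u * c = c := by
    rw [← sub_eq_zero, ← hc]
    ring
  by_contra hc0
  have hS : (decompose 𝒜 c).support.Nonempty := by
    rw [Finset.nonempty_iff_ne_empty]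
    intro hempty
    apply hc0
    rw [← sum_support_decompose 𝒜 c, hempty, Finset.sum_empty]
  set m : ℤ := (decompose 𝒜 c).support.min' hS with hm
  have hmS : m ∈ (decompose 𝒜 c).support := Finset.min'_mem _ hS
  have hnot : m - k ∉ (decompose 𝒜 c).support := by
    intro h
    have hle : m ≤ m - k := Finset.min'_le _ _ h
    omega
  have key := coe_decompose_mul_add_of_left_mem 𝒜 (b := c) (j := m - k) hu
  rw [huc, show k + (m - k) = m by omega, DFinsupp.notMem_support_iff.mp hnot,
    ZeroMemClass.coe_zero, mul_zero] at key
  exact DFinsupp.mem_support_iff.mp hmS (ZeroMemClass.coe_eq_zero.mp key)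

end Summit.ResolutionOfSingularities.ResolutionOfSingularities.Theorems.FInjectiveMacaulayfication.GradedZero
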